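import Summits.HodgeConjecture.CorCM.Census.HalfParityLaw

/-!
# The half-parity law, XI: only index-two subgroups containing EVERY stabiliser matter — the `𝒦`-criterion for `t = 0`

COR-CM (cell `pub-hodgecm2`), count-neutral kernel combinatorics by the binder seat b09 (gen 31; lane DIRECT-FACTOR, sequel
«CLOSED-FORM LAW» = lit-andre-3ʼs ask A6-R55), part XI of the HALF-PARITY series, sequel of `Census/HalfParityLaw.lean` (X).
Theorems only; no `decide` beyond closed identities in `𝔽₂`, no certificate, no named fact, no `sorry`.  HONEST FRAMING: `HC_CM` is
NOT proved; nothing here is a period or a headline.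

THE SHARPENING (`mem_rad2_of_par2_eq_zero_of_forall_lift_stab`).  In part X a Hodge vector mod `2` killed by the parities and by EVERY
liftable functional (every index-two `H ∋ c`) was shown to lie in `rad2`.  Here only the index-two subgroups `H ∋ c` that contain the
stabiliser `stab Ψ` of EVERY type `Ψ` are needed: the additive map `e` of the normal form `λ′(v·Q⁻¹) = λ′(v) + e(Q)·mass(v)` (IX)
kills every stabiliser (`λ′[Ψ·Q⁻¹] = λ′[Ψ]` forces `e(Q) = 0`), so `H = ker e ⊇ 𝒦 := ⟨stab Ψ : Ψ⟩` (lit-andre-3ʼs `𝒦(G,c)`,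
`= ⟨c, {g : c ∉ ⟨g⟩}⟩`).  CONSEQUENCE — **THE `𝒦`-CRITERION** (`fibreTwo_add_one_add_wdelta_eq_card_block_of_forall_exists_not_stab_le`):
**if no index-two subgroup containing `c` contains every stabiliser (i.e. `𝒦·` has no index-two overgroup through `c`, e.g. `𝒦 = G`),
then `hodge2 ∩ ker par2 ≤ rad2`, `t(G,c) = 0` and `φ₂ + 1 + δ = β`** — covering, beyond the complemented involutions of XIII
(`cplT` has stabiliser `A`, contained in no proper `H ∋ c`), the rows `D₄ (c = r²)`, `SL(2,3)`, `C₄⋊C₄ (c = (2,0))`, `D₄∘C₄`, every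
dihedral and every «`𝒦 = G`» type of lit-andre-3ʼs table (numerically: all `s = 0` rows of b09 g31ʼs sweep, `≈ 100` pairs).

## References
* [Pohlmann1968] H. Pohlmann, Algebraic cycles on abelian varieties of complex multiplication type, Ann. of Math. 88 (1968), Thm 1.
-/

namespace Summit.HodgeConjecture.CorCM.Census.HalfParity

open Finset
open Summit.HodgeConjecture.CorCM.Prior.AllgGroup.RfwfAllgGroup
open Summit.HodgeConjecture.CorCM.Census.BlockParity
open Summit.HodgeConjecture.CorCM.Census.Coinvariant

noncomputable section

variable {G : Type*} [Group G] [Fintype G] [DecidableEq G] (c : G)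

/-! ## §1 The additive map of the normal form kills every stabiliser -/

/-- **`e` kills stabilisers**: if `λ′(v·Q⁻¹) = λ′(v) + e(Q)·mass(v)` for all `v` and `Ψ·Q⁻¹ = Ψ`, then `e(Q) = 0`. [folklore] -/
theorem hom_eq_zero_of_mem_stab {lam' : (CMF G c →₀ ZMod 2) →ₗ[ZMod 2] ZMod 2} {e : G → ZMod 2}
    (he : ∀ (Q : G) (v : CMF G c →₀ ZMod 2), lam' (Finsupp.mapDomain (rt c Q) v) = lam' v + e Q * mass c v)
    {Q : G} {Ψ : CMF G c} (hQ : Q ∈ stab c Ψ) : e Q = 0 := by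
  have h := he Q (Finsupp.single Ψ 1)
  rw [Finsupp.mapDomain_single, (mem_stab c Ψ Q).mp hQ, mass_single, mul_one] at h
  have key : ∀ x y : ZMod 2, x = x + y → y = 0 := by decide
  exact key _ _ h

/-- Hence `ker e` contains every stabiliser. [folklore] -/
theorem stab_le_addKer {lam' : (CMF G c →₀ ZMod 2) →ₗ[ZMod 2] ZMod 2} {e : G → ZMod 2}
    (he : ∀ (Q : G) (v : CMF G c →₀ ZMod 2), lam' (Finsupp.mapDomain (rt c Q) v) = lam' v + e Q * mass c v)
    (hadd : ∀ a b : G, e (a * b) = e a + e b) (Ψ : CMF G c) : stab c Ψ ≤ addKer e hadd := fun _ hQ =>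
  (mem_addKer e hadd _).mpr (hom_eq_zero_of_mem_stab c he hQ)

/-! ## §2 The sharpened main lemma -/

/-- **MAIN, SHARPENED.**  A Hodge vector mod `2` with zero block parities which is killed by every functional that is
`H`-invariant on the ambient module and `G`-invariant on the faces, for every index-two `H ∋ c` CONTAINING EVERY STABILISER, lies in
`rad2`. [folklore] -/
theorem mem_rad2_of_par2_eq_zero_of_forall_lift_stab (hc2 : c * c = 1) (hc1 : c ≠ 1) (hcen : ∀ x : G, x * c = c * x)
    {x : CMF G c →₀ ZMod 2} (hx : x ∈ hodge2 c hc2) (hpx : par2 c x = 0)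
    (hlift : ∀ H : Subgroup G, H.index = 2 → c ∈ H → (∀ Ψ : CMF G c, stab c Ψ ≤ H) →
      ∀ w : (CMF G c →₀ ZMod 2) →ₗ[ZMod 2] ZMod 2,
        (∀ Q ∈ H, ∀ y : CMF G c →₀ ZMod 2, w (Finsupp.mapDomain (rt c Q) y) = w y) →
        (∀ (Q : G), ∀ y ∈ face2 c hc2, w (Finsupp.mapDomain (rt c Q) y) = w y) → w x = 0) :
    x ∈ rad2 c hc2 := by
  by_contra hxr
  obtain ⟨lam, hlx, hker⟩ := Submodule.exists_dual_map_eq_bot_of_notMem hxr inferInstance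
  have hrad : rad2 c hc2 ≤ LinearMap.ker lam := LinearMap.le_ker_iff_map.mpr hker
  have hpair : pair2 c ≤ LinearMap.ker lam := (pair2_le_rad2 c hc2).trans hrad
  have hinv : ∀ (Q : G), ∀ v ∈ hodge2 c hc2, lam (Finsupp.mapDomain (rt c Q) v) = lam v := fun Q v hv =>
    sub_eq_zero.mp (by rw [← map_sub]; exact LinearMap.mem_ker.mp (hrad (mapDomain_rt_sub_mem_rad2 c hc2 hcen Q hv)))
  obtain ⟨T, hT⟩ := exists_isCMF c hc2 hc1
  set T₀ : CMF G c := ⟨T, hT⟩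
  obtain ⟨μ, hμ, hμc, hw⟩ := exists_potential c hc2 hc1 hcen hpair hinv T₀
  obtain ⟨e, he, hadd, hec⟩ := exists_hom_of_potential c hc2 hc1 hcen hpair hinv T₀ hμ hμc
  rw [hw] at hec
  obtain ⟨a, ha⟩ := exists_forall_ts2_eq_of_mem_hodge2 c hc2 hcen hx
  have hx' : (lam + corr c T₀ μ) x ≠ 0 := by
    rw [LinearMap.add_apply, corr_eq_of_forall_ts2_eq c T₀ μ ha, hw, mul_zero, add_zero]
    exact hlx
  by_cases hall : ∀ g, e g = 0
  · obtain ⟨b, hb⟩ := exists_eq_sum_par2_of_invariant c (lam + corr c T₀ μ) fun Q v => by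
      rw [he, hall, zero_mul, add_zero]
    exact hx' (by rw [hb, hpx]; simp)
  · push Not at hall
    obtain ⟨g, hg⟩ := hall
    have two1 : ∀ y : ZMod 2, y ≠ 0 → y = 1 := by decide
    have hH := index_addKer e hadd (two1 _ hg)
    have hcH : c ∈ addKer e hadd := (mem_addKer e hadd c).mpr hec
    refine hx' (hlift (addKer e hadd) hH hcH (stab_le_addKer c he hadd) _ (fun Q hQ v => ?_) (fun Q v hv => ?_))
    · rw [he, (mem_addKer e hadd Q).mp hQ, zero_mul, add_zero]
    · rw [he, mass_eq_zero_of_mem_hodge2 c hc2 hcen (Submodule.mem_sup_left hv : v ∈ hodge2 c hc2), mul_zero, add_zero]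

/-! ## §3 The `𝒦`-criterion: no index-two `H ∋ c` through all stabilisers ⇒ the parity floor is the truth -/

/-- **If no index-two subgroup containing `c` contains every stabiliser, then `hodge2 ∩ ker par2 ≤ rad2`.** [folklore] -/
theorem mem_rad2_of_par2_eq_zero_of_forall_exists_not_stab_le (hc2 : c * c = 1) (hc1 : c ≠ 1) (hcen : ∀ x : G, x * c = c * x)
    (hK : ∀ H : Subgroup G, H.index = 2 → c ∈ H → ∃ Ψ : CMF G c, ¬ stab c Ψ ≤ H)
    {x : CMF G c →₀ ZMod 2} (hx : x ∈ hodge2 c hc2) (hpx : par2 c x = 0) : x ∈ rad2 c hc2 :=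
  mem_rad2_of_par2_eq_zero_of_forall_lift_stab c hc2 hc1 hcen hx hpx fun H hH hcH hst _ _ _ => by
    obtain ⟨Ψ, hΨ⟩ := hK H hH hcH
    exact absurd (hst Ψ) hΨ

/-- **THE `𝒦`-CRITERION: `φ₂ + 1 + δ = β`** when no index-two subgroup containing `c` contains every stabiliser. [folklore] -/
theorem fibreTwo_add_one_add_wdelta_eq_card_block_of_forall_exists_not_stab_le (hc2 : c * c = 1) (hc1 : c ≠ 1)
    (hcen : ∀ x : G, x * c = c * x) (hK : ∀ H : Subgroup G, H.index = 2 → c ∈ H → ∃ Ψ : CMF G c, ¬ stab c Ψ ≤ H)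
    (T₀ : CMF G c) : fibreTwo c hc2 + 1 + wdelta c T₀ = Fintype.card (Block c) := by
  refine le_antisymm ?_ (card_block_le_fibreTwo_add c hc2 T₀)
  have h1 := finrank_rad2_add_fibreTwo c hc2
  have h2 := finrank_map_add_finrank_inf_ker (par2 c) (hodge2 c hc2)
  have h3 : Module.finrank (ZMod 2) ↥(hodge2 c hc2 ⊓ LinearMap.ker (par2 c)) ≤ Module.finrank (ZMod 2) ↥(rad2 c hc2) :=
    Submodule.finrank_mono fun x hx =>
      mem_rad2_of_par2_eq_zero_of_forall_exists_not_stab_le c hc2 hc1 hcen hK hx.1 (LinearMap.mem_ker.mp hx.2)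
  have h4 := finrank_map_par2_hodge2_add c hc2 T₀
  omega

/-- **… and then `t(G, c) = 0`.** [folklore] -/
theorem halfRank_eq_zero_of_forall_exists_not_stab_le (hc2 : c * c = 1) (hc1 : c ≠ 1) (hcen : ∀ x : G, x * c = c * x)
    (hK : ∀ H : Subgroup G, H.index = 2 → c ∈ H → ∃ Ψ : CMF G c, ¬ stab c Ψ ≤ H) : halfRank c hc2 = 0 := by
  obtain ⟨T, hT⟩ := exists_isCMF c hc2 hc1
  exact (halfRank_eq_zero_iff c hc2 hc1 hcen ⟨T, hT⟩).mpr
    (fibreTwo_add_one_add_wdelta_eq_card_block_of_forall_exists_not_stab_le c hc2 hc1 hcen hK ⟨T, hT⟩)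

/-- **Complemented `c` is the first instance**: the complement type `A = cplT` has `stab A ⊇ A`, and no proper subgroup containing
`c` contains `A`. [folklore] -/
theorem forall_exists_not_stab_le_of_cpl (hc2 : c * c = 1) {A : Subgroup G} (hA : ∀ x : G, x ∈ A ↔ c * x ∉ A) :
    ∀ H : Subgroup G, H.index = 2 → c ∈ H → ∃ Ψ : CMF G c, ¬ stab c Ψ ≤ H := by
  intro H hH hcH
  refine ⟨cplT c A hA, fun hle => ?_⟩
  have hAH : A ≤ H := fun a ha => hle ((mem_stab c _ a).mpr (rt_cplT c hA ha))
  have htop : H = ⊤ := by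
    refine (Subgroup.eq_top_iff' H).mpr fun x => ?_
    by_cases hx : x ∈ A
    · exact hAH hx
    · have h := H.mul_mem hcH (hAH (cmul_mem_cpl c hA hx))
      rwa [← mul_assoc, hc2, one_mul] at h
  rw [htop, Subgroup.index_top] at hH
  exact absurd hH (by norm_num)

/-! ## §4 The normal form IS a stabiliser half-parity plus parities; `t` is the rank of the stabiliser half-parities -/

/-- Along a block: `Ψ = out(b)·Q⁻¹` lies in the `H`-half of `out(b)` iff `Q ∈ H`, when `stab(out b) ≤ H`. [folklore] -/
theorem mem_horb_out_iff {H : Subgroup G} {Φ : CMF G c} (hst : stab c Φ ≤ H) (Q : G) :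
    rt c Q Φ ∈ horb c H Φ ↔ Q ∈ H := by
  rw [mem_horb]
  constructor
  · rintro ⟨h, hh, he⟩
    have hmem : Q⁻¹ * h ∈ stab c Φ := by
      rw [mem_stab, rt_mul, he, rt_inv_rt]
    have h2 := H.mul_mem hh (H.inv_mem (hst hmem))
    rwa [mul_inv_rev, inv_inv, mul_inv_cancel_left] at h2
  · exact fun hQ => ⟨Q, hQ, rfl⟩

/-- Membership in the full stabiliser half `halfOf H univ` is read in the block of the type. [folklore] -/
theorem mem_halfOf_univ_iff (H : Subgroup G) (Ψ : CMF G c) :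
    Ψ ∈ halfOf c H univ ↔ Ψ ∈ horb c H (Quotient.out (blk c Ψ)) := by
  rw [mem_halfOf]
  constructor
  · rintro ⟨b, -, hb⟩
    rwa [blk_eq_of_mem_horb_out c H hb]
  · exact fun h => ⟨blk c Ψ, Finset.mem_univ _, h⟩

/-- **THE NORMAL FORM IS `ψ_H` PLUS PARITIES.**  If `w(v·Q⁻¹) = w(v) + e(Q)·mass(v)` with `e` additive and `H = ker e` of index
two containing every stabiliser, then `w = hsum (halfOf H univ) + Σ_b (w[out b] + 1)·par2_b` on ALL of `𝔽₂[types]`. [folklore] -/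
theorem apply_eq_hsum_halfOf_add_sum_par2 {w : (CMF G c →₀ ZMod 2) →ₗ[ZMod 2] ZMod 2} {e : G → ZMod 2}
    (he : ∀ (Q : G) (v : CMF G c →₀ ZMod 2), w (Finsupp.mapDomain (rt c Q) v) = w v + e Q * mass c v)
    (hadd : ∀ a b : G, e (a * b) = e a + e b) (hst : ∀ Ψ : CMF G c, stab c Ψ ≤ addKer e hadd) (v : CMF G c →₀ ZMod 2) :
    w v = hsum c (halfOf c (addKer e hadd) univ) v +
      ∑ b, (w (Finsupp.single (Quotient.out b) 1) + 1) * par2 c v b := by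
  induction v using Finsupp.induction_linear with
  | zero => simp
  | add f g hf hg => rw [map_add, map_add, hf, hg, map_add]; simp only [Pi.add_apply, mul_add, Finset.sum_add_distrib]; ring
  | single Ψ r =>
    rw [sum_mul_par2_single, hsum_single]
    have hb : blk c (Quotient.out (blk c Ψ)) = blk c Ψ := Quotient.out_eq _
    obtain ⟨Q, hQ⟩ := exists_rt_eq_of_blk_eq c hb
    have hw : w (Finsupp.single Ψ r) = r * (w (Finsupp.single (Quotient.out (blk c Ψ)) 1) + e Q) := by
      have h := he Q (Finsupp.single (Quotient.out (blk c Ψ)) r)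
      rw [Finsupp.mapDomain_single, hQ, mass_single] at h
      rw [h, ← Finsupp.smul_single_one (Quotient.out (blk c Ψ)) r, map_smul, smul_eq_mul]
      ring
    have hmem : Ψ ∈ halfOf c (addKer e hadd) univ ↔ Q ∈ addKer e hadd := by
      rw [mem_halfOf_univ_iff, ← mem_horb_out_iff c (hst (Quotient.out (blk c Ψ))) Q, hQ]
    rw [hw]
    have kpos : ∀ r u : ZMod 2, r * (u + 0) = r + r * (u + 1) := by decide
    have kneg : ∀ r u : ZMod 2, r * (u + 1) = 0 + r * (u + 1) := by decide
    by_cases hQH : Q ∈ addKer e hadd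
    · rw [if_pos (hmem.mpr hQH), (mem_addKer e hadd Q).mp hQH]
      exact kpos _ _
    · have two1 : ∀ y : ZMod 2, y ≠ 0 → y = 1 := by decide
      rw [if_neg (fun h => hQH (hmem.mp h)), two1 _ (fun h => hQH ((mem_addKer e hadd Q).mpr h))]
      exact kneg _ _

/-- **MAIN, CONCRETE FORM.**  A Hodge vector mod `2` with zero block parities, killed by the stabiliser half-parity
`hsum (halfOf H univ)` of every index-two `H ∋ c` containing every stabiliser, lies in `rad2`. [folklore] -/
theorem mem_rad2_of_par2_eq_zero_of_forall_hsum_halfOf_eq_zero (hc2 : c * c = 1) (hc1 : c ≠ 1)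
    (hcen : ∀ x : G, x * c = c * x) {x : CMF G c →₀ ZMod 2} (hx : x ∈ hodge2 c hc2) (hpx : par2 c x = 0)
    (hK : ∀ H : Subgroup G, H.index = 2 → c ∈ H → (∀ Ψ : CMF G c, stab c Ψ ≤ H) → hsum c (halfOf c H univ) x = 0) :
    x ∈ rad2 c hc2 := by
  by_contra hxr
  obtain ⟨lam, hlx, hker⟩ := Submodule.exists_dual_map_eq_bot_of_notMem hxr inferInstance
  have hrad : rad2 c hc2 ≤ LinearMap.ker lam := LinearMap.le_ker_iff_map.mpr hker
  have hpair : pair2 c ≤ LinearMap.ker lam := (pair2_le_rad2 c hc2).trans hrad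
  have hinv : ∀ (Q : G), ∀ v ∈ hodge2 c hc2, lam (Finsupp.mapDomain (rt c Q) v) = lam v := fun Q v hv =>
    sub_eq_zero.mp (by rw [← map_sub]; exact LinearMap.mem_ker.mp (hrad (mapDomain_rt_sub_mem_rad2 c hc2 hcen Q hv)))
  obtain ⟨T, hT⟩ := exists_isCMF c hc2 hc1
  set T₀ : CMF G c := ⟨T, hT⟩
  obtain ⟨μ, hμ, hμc, hw⟩ := exists_potential c hc2 hc1 hcen hpair hinv T₀
  obtain ⟨e, he, hadd, hec⟩ := exists_hom_of_potential c hc2 hc1 hcen hpair hinv T₀ hμ hμc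
  rw [hw] at hec
  obtain ⟨a, ha⟩ := exists_forall_ts2_eq_of_mem_hodge2 c hc2 hcen hx
  have hx' : (lam + corr c T₀ μ) x ≠ 0 := by
    rw [LinearMap.add_apply, corr_eq_of_forall_ts2_eq c T₀ μ ha, hw, mul_zero, add_zero]
    exact hlx
  by_cases hall : ∀ g, e g = 0
  · obtain ⟨b, hb⟩ := exists_eq_sum_par2_of_invariant c (lam + corr c T₀ μ) fun Q v => by
      rw [he, hall, zero_mul, add_zero]
    exact hx' (by rw [hb, hpx]; simp)
  · push Not at hall
    obtain ⟨g, hg⟩ := hall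
    have two1 : ∀ y : ZMod 2, y ≠ 0 → y = 1 := by decide
    have hH := index_addKer e hadd (two1 _ hg)
    have hcH : c ∈ addKer e hadd := (mem_addKer e hadd c).mpr hec
    have hst := stab_le_addKer c he hadd
    refine hx' ?_
    rw [apply_eq_hsum_halfOf_add_sum_par2 c he hadd hst, hK _ hH hcH hst, hpx]
    simp

/-- The full stabiliser half of an index-two `H ∋ c` through all stabilisers is ADMISSIBLE (part III). [folklore] -/
theorem halfOf_univ_mem_admHalves (hc2 : c * c = 1) {H : Subgroup G} (hH : H.index = 2) (hcH : c ∈ H)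
    (hst : ∀ Ψ : CMF G c, stab c Ψ ≤ H) : halfOf c H univ ∈ admHalves c hc2 :=
  mem_admHalves_of c hc2 hH hcH (halfOf_stable c H univ) (halfOf_disjoint c H fun Ψ _ => hst Ψ)
    (face2_le_ker_hsum_sat_of_forall_mem c fun Ψ => (mem_sat_halfOf_iff c H univ Ψ).mpr (Finset.mem_univ _))

/-- **`t(G, c)` IS THE RANK OF THE STABILISER HALF-PARITIES**: on `hodge2 ∩ ker par2`, the admissible half-parities of ALL pairs
`(R, H)` have the same rank as the full halves `hsum (halfOf H univ)` of the index-two `H ∋ c` containing every stabiliser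
(lit-andre-3ʼs corollary (i): every admissible pair reduces to `R =` all blocks, `H ⊇ 𝒦`). [folklore] -/
theorem halfRank_eq_finrank_map_stabHalves (hc2 : c * c = 1) (hc1 : c ≠ 1) (hcen : ∀ x : G, x * c = c * x) :
    halfRank c hc2 = Module.finrank (ZMod 2) ↥((hodge2 c hc2 ⊓ LinearMap.ker (par2 c)).map
      (LinearMap.pi fun H : {H : Subgroup G // H.index = 2 ∧ c ∈ H ∧ ∀ Ψ : CMF G c, stab c Ψ ≤ H} =>
        hsum c (halfOf c H.1 univ))) := by
  classical
  set L : (CMF G c →₀ ZMod 2) →ₗ[ZMod 2] ({H : Subgroup G // H.index = 2 ∧ c ∈ H ∧ ∀ Ψ : CMF G c, stab c Ψ ≤ H} → ZMod 2) :=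
    LinearMap.pi fun H => hsum c (halfOf c H.1 univ) with hL
  refine le_antisymm ?_ (finrank_map_pi_le_halfRank c hc2 _ fun H => halfOf_univ_mem_admHalves c hc2 H.2.1 H.2.2.1 H.2.2.2)
  obtain ⟨T, hT⟩ := exists_isCMF c hc2 hc1
  -- `hodge2 ∩ ker (par2, L) ≤ rad2`
  have hker : hodge2 c hc2 ⊓ LinearMap.ker ((par2 c).prod L) ≤ rad2 c hc2 := by
    rintro x ⟨hx, hk⟩
    rw [SetLike.mem_coe, LinearMap.mem_ker, LinearMap.prod_apply, Prod.mk_eq_zero] at hk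
    refine mem_rad2_of_par2_eq_zero_of_forall_hsum_halfOf_eq_zero c hc2 hc1 hcen hx hk.1 fun H hH hcH hst => ?_
    simpa [hL, LinearMap.pi_apply] using congrFun hk.2 ⟨H, hH, hcH, hst⟩
  have h1 := finrank_rad2_add_fibreTwo c hc2
  have h2 := finrank_map_add_finrank_inf_ker ((par2 c).prod L) (hodge2 c hc2)
  have h3 := Submodule.finrank_mono hker
  have h4 := finrank_map_prod_eq (par2 c) L (hodge2 c hc2)
  have h5 := finrank_map_par2_hodge2_add c hc2 ⟨T, hT⟩
  have h6 := card_block_add_halfRank_eq_fibreTwo_add c hc2 hc1 hcen ⟨T, hT⟩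
  omega

end

end Summit.HodgeConjecture.CorCM.Census.HalfParity
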